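import Mathlib.Analysis.Convex.Deriv
import Mathlib.Topology.Order.Monotone
import HarnessLib

/-!
# A convex function on `ℝ` is differentiable off a countable set

Helper (pure real analysis) for the energy programme of line `Sketch`, crux `FibreToTorus`
(stmt-QuantumFields-16244): applied to the (convex) lattice pressure `β ↦ f(β)` it says that for
all but countably many couplings `β` the pressure is differentiable, hence all
translation-invariant Gibbs states have the same energy density there.

Proof (folklore): for `f` convex on `ℝ` the one-sided derivatives
`∂⁻f(x) = derivWithin f (Iio x) x ≤ ∂⁺f(x) = derivWithin f (Ioi x) x` exist everywhere and
`∂⁺f` is monotone (`ConvexOn.monotoneOn_rightDeriv`); for `y < x`,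
`∂⁺f(y) ≤ slope f y x ≤ ∂⁻f(x)`, so if `∂⁺f` is continuous at `x` then letting `y ↑ x` gives
`∂⁺f(x) ≤ ∂⁻f(x)`, i.e. the two one-sided derivatives agree and `f` is differentiable at `x`
(gluing `HasDerivWithinAt` on `Iio x ∪ Ioi x`).  Hence the non-differentiability set is contained
in the discontinuity set of the monotone function `∂⁺f`, which is countable
(`Monotone.countable_not_continuousAt`).
-/

open Set Filter Topology

namespace Summit.QuantumFields.YangMills.Theorems.FibreToTorus

/-- If `f : ℝ → ℝ` is convex and its right derivative `y ↦ derivWithin f (Ioi y) y` is continuous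
at `x`, then `f` is differentiable at `x`: for `y < x` one has
`∂⁺f(y) ≤ slope f y x ≤ ∂⁻f(x) ≤ ∂⁺f(x)`, and letting `y ↑ x` forces `∂⁻f(x) = ∂⁺f(x)`.
[folklore] -/
theorem differentiableAt_of_convexOn_univ_of_continuousAt_rightDeriv {f : ℝ → ℝ}
    (hfc : ConvexOn ℝ univ f) {x : ℝ}
    (hc : ContinuousAt (fun y ↦ derivWithin f (Ioi y) y) x) : DifferentiableAt ℝ f x := by
  have hint : ∀ y : ℝ, y ∈ interior (univ : Set ℝ) := fun y ↦ by simp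
  have hL : HasDerivWithinAt f (derivWithin f (Iio x) x) (Iio x) x :=
    hfc.hasDerivWithinAt_leftDeriv_of_mem_interior (hint x)
  have hR : HasDerivWithinAt f (derivWithin f (Ioi x) x) (Ioi x) x :=
    hfc.hasDerivWithinAt_rightDeriv_of_mem_interior (hint x)
  have h1 : derivWithin f (Iio x) x ≤ derivWithin f (Ioi x) x :=
    hfc.leftDeriv_le_rightDeriv_of_mem_interior (hint x)
  have h2 : ∀ y < x, derivWithin f (Ioi y) y ≤ derivWithin f (Iio x) x := fun y hy ↦
    (hfc.rightDeriv_le_slope_of_mem_interior (hint y) (mem_univ x) hy).trans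
      (hfc.slope_le_leftDeriv_of_mem_interior (mem_univ y) (hint x) hy)
  have h3 : derivWithin f (Ioi x) x ≤ derivWithin f (Iio x) x := by
    have ht : Tendsto (fun y ↦ derivWithin f (Ioi y) y) (𝓝[<] x)
        (𝓝 (derivWithin f (Ioi x) x)) :=
      hc.tendsto.mono_left nhdsWithin_le_nhds
    refine le_of_tendsto ht ?_
    filter_upwards [self_mem_nhdsWithin] with y hy using h2 y hy
  have heq : derivWithin f (Iio x) x = derivWithin f (Ioi x) x := le_antisymm h1 h3
  rw [heq] at hL
  have hu : HasDerivWithinAt f (derivWithin f (Ioi x) x) (Iio x ∪ Ioi x) x := hL.union hR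
  rw [Iio_union_Ioi, compl_eq_univ_sdiff, hasDerivWithinAt_sdiff_singleton,
    hasDerivWithinAt_univ] at hu
  exact hu.differentiableAt

/-- **A convex function on `ℝ` is differentiable except at countably many points.**
The non-differentiability set of a convex `f : ℝ → ℝ` is contained in the discontinuity set of
its (monotone) right derivative, which is countable. [folklore] -/
theorem convexOn_univ_countable_not_differentiableAt : ∀ f : ℝ → ℝ, ConvexOn ℝ Set.univ f → Set.Countable {x : ℝ | ¬ DifferentiableAt ℝ f x} := by
  intro f hfc
  have hint : ∀ y : ℝ, y ∈ interior (univ : Set ℝ) := fun y ↦ by simp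
  have hmono : Monotone (fun y ↦ derivWithin f (Ioi y) y) := fun a b hab ↦
    hfc.monotoneOn_rightDeriv (hint a) (hint b) hab
  refine hmono.countable_not_continuousAt.mono ?_
  intro x hx hc
  exact hx (differentiableAt_of_convexOn_univ_of_continuousAt_rightDeriv hfc hc)

end Summit.QuantumFields.YangMills.Theorems.FibreToTorus
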